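/-
Copyright (c) 2026. All rights reserved.
Released under Apache 2.0 license as described in the file LICENSE.
b2b-lace LEAN TYPING SEAT 1 (lean1-g37): the cube of an axis character in classes and the exact `D^{sin}` second
moment at the node `2e_i` (KU-SEP row input for `U_{n,0}(2e_i)`).
-/
import Literature.Probability.FitznerVanDerHofstad2017.SrwTwistClassMass
import Literature.Probability.FitznerVanDerHofstad2017.SrwTwistWeightClasses
import Literature.Probability.FitznerVanDerHofstad2017.SrwTwistProductWeight
import Literature.Probability.FitznerVanDerHofstad2017.SrwIntegralM2X
import Literature.Probability.FitznerVanDerHofstad2017.SrwChatPowSchwinger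
import Literature.Probability.FitznerVanDerHofstad2017.SrwRegionSplitAxisCells
import HarnessLib

/-!
# The cube `∫ D̂^{(m e_i)}(k)³ Ĉ(k)ⁿ` in classes and the exact second moment `Sq^{D^{sin}}_n(2e_i)`

Fitzner–van der Hofstad bound the SRW integrals `U_{n,0}(x) = ∫ D^{sin} |D̂^{(x)}| Ĉⁿ dk/(2π)^d`
[cite: FitznerVanDerHofstad2016NoBLE, (5.9) p. 1092] at a node `x` through a certified even majorant of `|y|`
(`|y| ≤ g(y)` with `g` a trigonometric/polynomial even function), which turns `U_{n,0}(x)` into a combination of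
the twisted moments `Tw^{D^{sin}}_n(x;β)` and the second moment `Sq^{D^{sin}}_n(x) = ∫ D^{sin} D̂^{(x)2} Ĉⁿ`
[cite: FitznerVanDerHofstad2016NoBLE, (3.34)–(3.38) p. 1071, §5.2 p. 1091–1092].  The tree so far bounds
`Sq^{D^{sin}}_n(m e_i)` by `D^{sin} ≤ 1/d` (`SrwTrigMajorantEncl`) or by Jensen (`SrwSqMomDsinJensen`).  At the
node `2e_i` the second moment is an EXACT combination of plain seeds: since
`D^{sin}(k) = (1 − D̂(2k))/(2d)` (`Dsin_eq_half_angle`) and `D̂(2k) = D̂^{(2e_i)}(k)` (`DhatSym_single_two`),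

  `Sq^{D^{sin}}_n(2e_i) = (L_n(2e_i) − ∫ D̂^{(2e_i)}(k)³ Ĉⁿ)/(2d)`,

with `L_n(2e_i)` in classes by `srwL_single_eq_classes` and the CUBE of an axis character in classes by the
main identity of this file (`d ≥ 2n+1`, `i, j, l` pairwise distinct, any `m : ℤ`):

  `∫ D̂^{(m e_i)}(k)³ Ĉ(k)ⁿ dk/(2π)^d = ((d−1)(d−2)/d²)·I_{n,0}(m e_i + m e_j + m e_l)
      + (3(d−1)/(2d²))·(I_{n,0}(m e_i) + I_{n,0}(2m e_i + m e_j)) + (1/(4d²))·(3 I_{n,0}(m e_i) + I_{n,0}(3m e_i))`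

(`srwTwist_DhatSym_single_pow_three_zero_eq`).  Proof: `d·D̂^{(m e_i)}(k) = Σ_s cos(m k_s)`
(`natCast_mul_DhatSym_single_intCast`), so `d³ D̂^{(m e_i)}³ = Σ_{s,t,u} cos(m k_s) cos(m k_t) cos(m k_u)`; by
linearity of `Tw` in the weight (`srwTwist_sum_weight`) the cube is a triple sum of product-cosine masses, each a
plain seed by the class-mass lemmas of `SrwTwistClassMass` (`cos³ = (3cos + cos 3·)/4`, `cos² = (1 + cos 2·)/2`,
three distinct indices = the class `[m,m,m]`), transported to reference indices by coordinate permutations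
(`srwTwist_weight_comp_perm`, `srwTwist_transport₂'`); the triple sum is then regrouped by the diagonal pattern
of `(s,t,u)`.  The last theorem is the `ℚ`-literal enclosure form consumed by the KU-SEP `U_{n,0}` cells at `2e_i`
(`srwU_zero_le_gset_classEncl_cast`, hypothesis `hS`).

Epistemic status: exact identities for the simple-random-walk integrals of [FitznerVanDerHofstad2016NoBLE, §5];
no numerical input.
-/

namespace Literature.Probability.FitznerVanDerHofstad2017

open MeasureTheory Real Finset
open Literature.Barriers.CriticalPhenomena
open Literature.Barriers.CriticalPhenomena.Slade2006Prop53 (P)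

variable {d : ℕ}

namespace DsinCube

/-! ### §1  Small analytic and combinatorial helpers -/

/-- `k ↦ cos(c k_i)` is measurable. [folklore] -/
private theorem measurable_cos_cmul (c : ℝ) (i : Fin d) :
    Measurable fun k : Fin d → ℝ => Real.cos (c * k i) :=
  Real.continuous_cos.measurable.comp (measurable_const.mul (measurable_pi_apply i))

/-- Two-term linearity of `Tw` for bounded measurable weights. [folklore] -/
private theorem lin₂ {n : ℕ} (hd : 2 * n + 1 ≤ d) (c₁ c₂ : ℝ) (w₁ w₂ : (Fin d → ℝ) → ℝ)
    (h₁ : Measurable w₁) (h₂ : Measurable w₂) {W₁ W₂ : ℝ} (hb₁ : ∀ k, |w₁ k| ≤ W₁)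
    (hb₂ : ∀ k, |w₂ k| ≤ W₂) (x : Fin d → ℤ) (β : ℝ) :
    srwTwist d n (fun k => c₁ * w₁ k + c₂ * w₂ k) x β
      = c₁ * srwTwist d n w₁ x β + c₂ * srwTwist d n w₂ x β := by
  rw [srwTwist_add_weight (fun k => c₁ * w₁ k) (fun k => c₂ * w₂ k) x β, srwTwist_const_mul_weight,
    srwTwist_const_mul_weight]
  · exact integrable_weight_cos_mul_Chat_pow hd (w := fun k => c₁ * w₁ k) (measurable_const.mul h₁)
      (W := |c₁| * W₁) (fun k => by rw [abs_mul]; exact mul_le_mul_of_nonneg_left (hb₁ k) (abs_nonneg _)) x β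
  · exact integrable_weight_cos_mul_Chat_pow hd (w := fun k => c₂ * w₂ k) (measurable_const.mul h₂)
      (W := |c₂| * W₂) (fun k => by rw [abs_mul]; exact mul_le_mul_of_nonneg_left (hb₂ k) (abs_nonneg _)) x β

/-- `|Σ_{i∈s} f i| ≤ Σ_{i∈s} C` from a termwise bound. [folklore] -/
private theorem abs_sum_le_sum_const {ι : Type*} (s : Finset ι) (f : ι → ℝ) (C : ℝ)
    (h : ∀ i ∈ s, |f i| ≤ C) : |∑ i ∈ s, f i| ≤ ∑ _i ∈ s, C :=
  (Finset.abs_sum_le_sum_abs _ _).trans (Finset.sum_le_sum h)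

/-- `|cos a cos b cos c| ≤ 1`. [folklore] -/
private theorem abs_ccc_le (a b c : ℝ) : |Real.cos a * Real.cos b * Real.cos c| ≤ 1 := by
  rw [abs_mul, abs_mul]
  exact mul_le_one₀ (mul_le_one₀ (Real.abs_cos_le_one _) (abs_nonneg _) (Real.abs_cos_le_one _))
    (abs_nonneg _) (Real.abs_cos_le_one _)

/-- `Σ_u F u = F s + (d−1)·A` when `F = A` off the marked index `s`. [folklore] -/
private theorem sum_marked₁ (F : Fin d → ℝ) (s : Fin d) {A : ℝ} (h : ∀ u, u ≠ s → F u = A) :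
    ∑ u, F u = F s + ((d : ℝ) - 1) * A := by
  rw [← Finset.add_sum_erase _ _ (mem_univ s)]
  congr 1
  rw [Finset.sum_congr rfl (fun u hu => h u (Finset.ne_of_mem_erase hu)), Finset.sum_const,
    Finset.card_erase_of_mem (mem_univ s), Finset.card_univ, Fintype.card_fin, nsmul_eq_mul,
    Nat.cast_sub (Fin.pos s), Nat.cast_one]

/-- `Σ_u F u = F s + F t + (d−2)·A` when `F = A` off the two marked indices `s ≠ t`. [folklore] -/
private theorem sum_marked₂ (F : Fin d → ℝ) {s t : Fin d} (hst : s ≠ t) {A : ℝ}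
    (h : ∀ u, u ≠ s → u ≠ t → F u = A) :
    ∑ u, F u = F s + F t + ((d : ℝ) - 2) * A := by
  have ht : t ∈ univ.erase s := Finset.mem_erase.mpr ⟨hst.symm, mem_univ t⟩
  have h2 : 2 ≤ d := by
    have h1 : 1 < d := by
      have := Fintype.one_lt_card_iff.mpr ⟨s, t, hst⟩
      simpa [Fintype.card_fin] using this
    omega
  rw [← Finset.add_sum_erase _ _ (mem_univ s), ← Finset.add_sum_erase _ _ ht, add_assoc]
  congr 2
  rw [Finset.sum_congr rfl (fun u hu => h u (Finset.ne_of_mem_erase (Finset.mem_of_mem_erase hu))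
      (Finset.ne_of_mem_erase hu)), Finset.sum_const, Finset.card_erase_of_mem ht,
    Finset.card_erase_of_mem (mem_univ s), Finset.card_univ, Fintype.card_fin, nsmul_eq_mul,
    show d - 1 - 1 = d - 2 by omega, Nat.cast_sub h2, Nat.cast_ofNat]

/-- A coordinate permutation with three prescribed values `i ↦ s`, `j ↦ t`, `l ↦ u` (both triples pairwise
distinct). [folklore] -/
private theorem exists_perm_apply₃ {i j l s t u : Fin d} (hij : i ≠ j) (hil : i ≠ l) (hjl : j ≠ l)
    (hst : s ≠ t) (hsu : s ≠ u) (htu : t ≠ u) :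
    ∃ σ : Equiv.Perm (Fin d), σ i = s ∧ σ j = t ∧ σ l = u := by
  -- first swap: `i ↦ s`
  set σ₁ : Equiv.Perm (Fin d) := Equiv.swap i s with hσ₁
  have h1i : σ₁ i = s := Equiv.swap_apply_left i s
  have hj₁s : σ₁ j ≠ s := fun h => hij (σ₁.injective (h1i.trans h.symm))
  -- second swap: `σ₁ j ↦ t`, fixing `s`
  set σ₂ : Equiv.Perm (Fin d) := Equiv.swap (σ₁ j) t with hσ₂
  have h2j : σ₂ (σ₁ j) = t := Equiv.swap_apply_left _ _
  have h2s : σ₂ s = s := Equiv.swap_apply_of_ne_of_ne hj₁s.symm hst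
  have hl₂s : σ₂ (σ₁ l) ≠ s := by
    intro h
    have : σ₂ (σ₁ l) = σ₂ (σ₁ i) := by rw [h, h1i, h2s]
    exact hil (σ₁.injective (σ₂.injective this)).symm
  have hl₂t : σ₂ (σ₁ l) ≠ t := by
    intro h
    have : σ₂ (σ₁ l) = σ₂ (σ₁ j) := by rw [h, h2j]
    exact hjl (σ₁.injective (σ₂.injective this)).symm
  -- third swap: `σ₂ (σ₁ l) ↦ u`, fixing `s` and `t`
  set σ₃ : Equiv.Perm (Fin d) := Equiv.swap (σ₂ (σ₁ l)) u with hσ₃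
  have h3l : σ₃ (σ₂ (σ₁ l)) = u := Equiv.swap_apply_left _ _
  have h3s : σ₃ s = s := Equiv.swap_apply_of_ne_of_ne hl₂s.symm hsu
  have h3t : σ₃ t = t := Equiv.swap_apply_of_ne_of_ne hl₂t.symm htu
  refine ⟨σ₁.trans (σ₂.trans σ₃), ?_, ?_, ?_⟩
  · simp only [Equiv.trans_apply, h1i, h2s, h3s]
  · simp only [Equiv.trans_apply, h2j, h3t]
  · simp only [Equiv.trans_apply, h3l]

/-- `I_{n,0}(a e_s) = I_{n,0}(a e_i)`. [cite: FitznerVanDerHofstad2016NoBLE, (5.17) p. 1092] -/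
private theorem srwI_single_eq (n : ℕ) (s i : Fin d) (a : ℤ) :
    srwI d n 0 (Pi.single s a) = srwI d n 0 (Pi.single i a) :=
  apply_single_eq_of_spInvariant (F := srwI d n 0) (fun τ x => srwI_spAct n 0 τ x) s i a

/-! ### §2  Product-cosine masses with repeated indices -/

/-- **`cos³` class at one index**: `Tw^{cos(m k_s)·cos(m k_s)·cos(m k_s)}_n(x;0) = (3 I_{n,0}(m e_i) + I_{n,0}(3m e_i))/4`.
[cite: FitznerVanDerHofstad2016NoBLE, (3.34)–(3.35) p. 1071] -/
theorem srwTwist_cos_intMul_cube_zero_eq {n : ℕ} (hd : 2 * n + 1 ≤ d) (s i : Fin d) (m : ℤ)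
    (x : Fin d → ℤ) :
    srwTwist d n (fun k => Real.cos ((m : ℝ) * k s) * Real.cos ((m : ℝ) * k s) * Real.cos ((m : ℝ) * k s)) x 0
      = (3 * srwI d n 0 (Pi.single i m) + srwI d n 0 (Pi.single i (3 * m))) / 4 := by
  have hw : (fun k : Fin d → ℝ => Real.cos ((m : ℝ) * k s) * Real.cos ((m : ℝ) * k s) * Real.cos ((m : ℝ) * k s))
      = fun k => (3 / 4 : ℝ) * Real.cos ((m : ℝ) * k s) + (1 / 4 : ℝ) * Real.cos (((3 * m : ℤ) : ℝ) * k s) := by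
    funext k
    have h3 := Real.cos_three_mul ((m : ℝ) * k s)
    push_cast
    rw [show (3 : ℝ) * (m : ℝ) * k s = 3 * ((m : ℝ) * k s) by ring, h3]
    ring
  rw [hw, lin₂ hd _ _ _ _ (measurable_cos_cmul _ s) (measurable_cos_cmul _ s)
      (fun k => Real.abs_cos_le_one _) (fun k => Real.abs_cos_le_one _) x 0,
    srwTwist_cos_intMul_zero_eq_srwI hd s m x, srwTwist_cos_intMul_zero_eq_srwI hd s (3 * m) x,
    srwI_single_eq n s i m, srwI_single_eq n s i (3 * m)]
  ring

/-- **`cos²·cos` class at two indices**: for `s ≠ u` and a reference pair `i ≠ j`,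
`Tw^{cos²(m k_s)·cos(m k_u)}_n(x;0) = (I_{n,0}(m e_i) + I_{n,0}(2m e_i + m e_j))/2`.
[cite: FitznerVanDerHofstad2016NoBLE, (3.34)–(3.35) p. 1071] -/
theorem srwTwist_cos_sq_mul_cos_intMul_zero_eq {n : ℕ} (hd : 2 * n + 1 ≤ d) {s u i j : Fin d} (hsu : s ≠ u)
    (hij : i ≠ j) (m : ℤ) (x : Fin d → ℤ) :
    srwTwist d n (fun k => Real.cos ((m : ℝ) * k s) ^ 2 * Real.cos ((m : ℝ) * k u)) x 0
      = (srwI d n 0 (Pi.single i m) + srwI d n 0 (Pi.single i (2 * m) + Pi.single j m)) / 2 := by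
  have hw : (fun k : Fin d → ℝ => Real.cos ((m : ℝ) * k s) ^ 2 * Real.cos ((m : ℝ) * k u))
      = fun k => (1 / 2 : ℝ) * Real.cos ((m : ℝ) * k u)
          + (1 / 2 : ℝ) * (Real.cos (((2 * m : ℤ) : ℝ) * k s) * Real.cos ((m : ℝ) * k u)) := by
    funext k
    rw [Real.cos_sq ((m : ℝ) * k s)]
    push_cast
    rw [show (2 : ℝ) * (m : ℝ) * k s = 2 * ((m : ℝ) * k s) by ring]
    ring
  have hm2 : Measurable fun k : Fin d → ℝ => Real.cos (((2 * m : ℤ) : ℝ) * k s) * Real.cos ((m : ℝ) * k u) :=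
    (measurable_cos_cmul _ s).mul (measurable_cos_cmul _ u)
  have hb2 : ∀ k : Fin d → ℝ, |Real.cos (((2 * m : ℤ) : ℝ) * k s) * Real.cos ((m : ℝ) * k u)| ≤ 1 := by
    intro k; rw [abs_mul]
    exact mul_le_one₀ (Real.abs_cos_le_one _) (abs_nonneg _) (Real.abs_cos_le_one _)
  -- transport the pair `(s,u)` to the reference pair `(i,j)`
  have ht := srwTwist_transport₂' (n := n) (fun _ => (1 : ℝ)) (fun t => Real.cos (((2 * m : ℤ) : ℝ) * t))
    (fun t => Real.cos ((m : ℝ) * t)) (fun _ _ => rfl) hij hsu x 0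
  simp only [one_mul] at ht
  rw [hw, lin₂ hd _ _ _ _ (measurable_cos_cmul _ u) hm2 (fun k => Real.abs_cos_le_one _) hb2 x 0,
    srwTwist_cos_intMul_zero_eq_srwI hd u m x, srwI_single_eq n u i m, ht,
    srwTwist_cos_mul_cos_intMul_zero_eq_srwI hd hij (2 * m) m x]
  ring

/-- **Three distinct indices transported**: for pairwise distinct `s, t, u` and a reference triple `i, j, l`,
`Tw^{cos(m k_s) cos(m k_t) cos(m k_u)}_n(x;0) = I_{n,0}(m e_i + m e_j + m e_l)`.
[cite: FitznerVanDerHofstad2016NoBLE, (3.34)–(3.35) p. 1071] -/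
theorem srwTwist_cos_mul_cos_mul_cos_intMul_zero_eq_ref {n : ℕ} (hd : 2 * n + 1 ≤ d) {s t u i j l : Fin d}
    (hst : s ≠ t) (hsu : s ≠ u) (htu : t ≠ u) (hij : i ≠ j) (hil : i ≠ l) (hjl : j ≠ l) (m : ℤ)
    (x : Fin d → ℤ) :
    srwTwist d n (fun k => Real.cos ((m : ℝ) * k s) * Real.cos ((m : ℝ) * k t) * Real.cos ((m : ℝ) * k u)) x 0
      = srwI d n 0 (Pi.single i m + Pi.single j m + Pi.single l m) := by
  obtain ⟨σ, hσi, hσj, hσl⟩ := exists_perm_apply₃ hij hil hjl hst hsu htu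
  have h := srwTwist_weight_comp_perm (n := n) σ
    (fun k => Real.cos ((m : ℝ) * k i) * Real.cos ((m : ℝ) * k j) * Real.cos ((m : ℝ) * k l)) x 0
  simp only [Function.comp_apply, hσi, hσj, hσl] at h
  rw [h]
  exact srwTwist_cos_mul_cos_mul_cos_intMul_zero_eq_srwI hd hij hil hjl m m m x

/-! ### §3  The cube of an axis character in classes -/

/-- Pointwise: `D̂^{(m e_i)}(k)³ = Σ_s Σ_t Σ_u d⁻³ cos(m k_s) cos(m k_t) cos(m k_u)`.
[cite: FitznerVanDerHofstad2016NoBLE, (3.34) p. 1071] -/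
private theorem DhatSym_single_pow_three_eq_sum (i : Fin d) (m : ℤ) (k : Fin d → ℝ) :
    DhatSym d (Pi.single i m) k ^ 3
      = ∑ s, ∑ t, ∑ u, (1 / (d : ℝ) ^ 3)
          * (Real.cos ((m : ℝ) * k s) * Real.cos ((m : ℝ) * k t) * Real.cos ((m : ℝ) * k u)) := by
  have hd0 : (d : ℝ) ≠ 0 := by exact_mod_cast (Fin.pos i).ne'
  have hD : DhatSym d (Pi.single i m) k = (∑ s, Real.cos ((m : ℝ) * k s)) / d := by
    rw [eq_div_iff hd0, mul_comm]; exact natCast_mul_DhatSym_single_intCast i m k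
  have hS3 : (∑ s, Real.cos ((m : ℝ) * k s)) ^ 3
      = ∑ s, ∑ t, ∑ u, Real.cos ((m : ℝ) * k s) * Real.cos ((m : ℝ) * k t) * Real.cos ((m : ℝ) * k u) := by
    rw [pow_succ, pow_two, Finset.sum_mul_sum, Finset.sum_mul]
    refine Finset.sum_congr rfl fun s _ => ?_
    rw [Finset.sum_mul]
    refine Finset.sum_congr rfl fun t _ => ?_
    rw [Finset.mul_sum]
  rw [hD, div_pow, hS3]
  simp only [Finset.sum_div]
  refine Finset.sum_congr rfl fun s _ => Finset.sum_congr rfl fun t _ => Finset.sum_congr rfl fun u _ => ?_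
  ring

/-- Three-level linearity of `Tw` in the weight (bounded measurable summands, one common coefficient). [folklore] -/
private theorem srwTwist_sum₃_weight {n : ℕ} (hd : 2 * n + 1 ≤ d) (a : ℝ)
    (f : Fin d → Fin d → Fin d → (Fin d → ℝ) → ℝ) (hfm : ∀ s t u, Measurable (f s t u))
    (hfb : ∀ s t u k, |f s t u k| ≤ 1) (x : Fin d → ℤ) (β : ℝ) :
    srwTwist d n (fun k => ∑ s, ∑ t, ∑ u, a * f s t u k) x β
      = ∑ s, ∑ t, ∑ u, a * srwTwist d n (f s t u) x β := by
  -- innermost level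
  have h3 : ∀ s t, srwTwist d n (fun k => ∑ u, a * f s t u k) x β = ∑ u, a * srwTwist d n (f s t u) x β :=
    fun s t => srwTwist_sum_weight univ (fun _ => a) (f s t) hd (fun u _ => hfm s t u)
      (fun u _ => ⟨1, hfb s t u⟩) x β
  have hm3 : ∀ s t, Measurable fun k => ∑ u, a * f s t u k :=
    fun s t => Finset.measurable_sum univ fun u _ => measurable_const.mul (hfm s t u)
  have hb3 : ∀ s t k, |∑ u, a * f s t u k| ≤ ∑ _u : Fin d, |a| := by
    intro s t k
    refine abs_sum_le_sum_const univ _ |a| fun u _ => ?_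
    rw [abs_mul]
    exact mul_le_of_le_one_right (abs_nonneg a) (hfb s t u k)
  -- middle level
  have h2 : ∀ s, srwTwist d n (fun k => ∑ t, (1 : ℝ) * ∑ u, a * f s t u k) x β
      = ∑ t, (1 : ℝ) * srwTwist d n (fun k => ∑ u, a * f s t u k) x β :=
    fun s => srwTwist_sum_weight univ (fun _ => (1 : ℝ)) (fun t k => ∑ u, a * f s t u k) hd
      (fun t _ => hm3 s t) (fun t _ => ⟨_, hb3 s t⟩) x β
  simp only [one_mul] at h2
  have hm2 : ∀ s, Measurable fun k => ∑ t, ∑ u, a * f s t u k :=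
    fun s => Finset.measurable_sum univ fun t _ => hm3 s t
  have hb2 : ∀ s k, |∑ t, ∑ u, a * f s t u k| ≤ ∑ _t : Fin d, ∑ _u : Fin d, |a| :=
    fun s k => abs_sum_le_sum_const univ _ _ fun t _ => hb3 s t k
  -- outer level
  have h1 : srwTwist d n (fun k => ∑ s, (1 : ℝ) * ∑ t, ∑ u, a * f s t u k) x β
      = ∑ s, (1 : ℝ) * srwTwist d n (fun k => ∑ t, ∑ u, a * f s t u k) x β :=
    srwTwist_sum_weight univ (fun _ => (1 : ℝ)) (fun s k => ∑ t, ∑ u, a * f s t u k) hd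
      (fun s _ => hm2 s) (fun s _ => ⟨_, hb2 s⟩) x β
  simp only [one_mul] at h1
  rw [h1]
  refine Finset.sum_congr rfl fun s _ => ?_
  rw [h2 s]
  exact Finset.sum_congr rfl fun t _ => h3 s t

/-- **The cube of an axis character in classes.** For `d ≥ 2n+1`, pairwise distinct `i, j, l` and any `m : ℤ`,
`∫ D̂^{(m e_i)}(k)³ Ĉ(k)ⁿ dk/(2π)^d = ((d−1)(d−2)/d²)·I_{n,0}(m e_i + m e_j + m e_l)
  + (3(d−1)/(2d²))·(I_{n,0}(m e_i) + I_{n,0}(2m e_i + m e_j)) + (1/(4d²))·(3 I_{n,0}(m e_i) + I_{n,0}(3m e_i))`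
(the left side written as the twisted moment `Tw^{D̂^{(m e_i)3}}_n(x;0)`, any `x`).
[cite: FitznerVanDerHofstad2016NoBLE, (3.34)–(3.38) p. 1071; (5.7), (5.9) pp. 1091–1092] -/
theorem srwTwist_DhatSym_single_pow_three_zero_eq {n : ℕ} (hd : 2 * n + 1 ≤ d) {i j l : Fin d}
    (hij : i ≠ j) (hil : i ≠ l) (hjl : j ≠ l) (m : ℤ) (x : Fin d → ℤ) :
    srwTwist d n (fun k => DhatSym d (Pi.single i m) k ^ 3) x 0
      = ((d : ℝ) - 1) * ((d : ℝ) - 2) / (d : ℝ) ^ 2 * srwI d n 0 (Pi.single i m + Pi.single j m + Pi.single l m)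
        + 3 * ((d : ℝ) - 1) / (2 * (d : ℝ) ^ 2)
            * (srwI d n 0 (Pi.single i m) + srwI d n 0 (Pi.single i (2 * m) + Pi.single j m))
        + 1 / (4 * (d : ℝ) ^ 2) * (3 * srwI d n 0 (Pi.single i m) + srwI d n 0 (Pi.single i (3 * m))) := by
  classical
  have hd0 : (d : ℝ) ≠ 0 := by exact_mod_cast (Fin.pos i).ne'
  -- the three values of the product-cosine masses
  have hsq : ∀ s u : Fin d, s ≠ u →
      srwTwist d n (fun k => Real.cos ((m : ℝ) * k s) * Real.cos ((m : ℝ) * k s) * Real.cos ((m : ℝ) * k u)) x 0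
        = (srwI d n 0 (Pi.single i m) + srwI d n 0 (Pi.single i (2 * m) + Pi.single j m)) / 2 := by
    intro s u hsu
    rw [show (fun k : Fin d → ℝ => Real.cos ((m : ℝ) * k s) * Real.cos ((m : ℝ) * k s) * Real.cos ((m : ℝ) * k u))
        = fun k => Real.cos ((m : ℝ) * k s) ^ 2 * Real.cos ((m : ℝ) * k u) from funext fun k => by ring]
    exact srwTwist_cos_sq_mul_cos_intMul_zero_eq hd hsu hij m x
  have hsq' : ∀ s u : Fin d, s ≠ u →
      srwTwist d n (fun k => Real.cos ((m : ℝ) * k u) * Real.cos ((m : ℝ) * k s) * Real.cos ((m : ℝ) * k s)) x 0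
        = (srwI d n 0 (Pi.single i m) + srwI d n 0 (Pi.single i (2 * m) + Pi.single j m)) / 2 := by
    intro s u hsu
    rw [show (fun k : Fin d → ℝ => Real.cos ((m : ℝ) * k u) * Real.cos ((m : ℝ) * k s) * Real.cos ((m : ℝ) * k s))
        = fun k => Real.cos ((m : ℝ) * k s) ^ 2 * Real.cos ((m : ℝ) * k u) from funext fun k => by ring]
    exact srwTwist_cos_sq_mul_cos_intMul_zero_eq hd hsu hij m x
  have hsq'' : ∀ s u : Fin d, s ≠ u →
      srwTwist d n (fun k => Real.cos ((m : ℝ) * k s) * Real.cos ((m : ℝ) * k u) * Real.cos ((m : ℝ) * k s)) x 0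
        = (srwI d n 0 (Pi.single i m) + srwI d n 0 (Pi.single i (2 * m) + Pi.single j m)) / 2 := by
    intro s u hsu
    rw [show (fun k : Fin d → ℝ => Real.cos ((m : ℝ) * k s) * Real.cos ((m : ℝ) * k u) * Real.cos ((m : ℝ) * k s))
        = fun k => Real.cos ((m : ℝ) * k s) ^ 2 * Real.cos ((m : ℝ) * k u) from funext fun k => by ring]
    exact srwTwist_cos_sq_mul_cos_intMul_zero_eq hd hsu hij m x
  -- inner sums, diagonal pattern `s = t`
  have hdiag : ∀ s : Fin d,
      ∑ u, srwTwist d n (fun k => Real.cos ((m : ℝ) * k s) * Real.cos ((m : ℝ) * k s) * Real.cos ((m : ℝ) * k u)) x 0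
        = (3 * srwI d n 0 (Pi.single i m) + srwI d n 0 (Pi.single i (3 * m))) / 4
          + ((d : ℝ) - 1) * ((srwI d n 0 (Pi.single i m) + srwI d n 0 (Pi.single i (2 * m) + Pi.single j m)) / 2) := by
    intro s
    rw [sum_marked₁ (fun u => srwTwist d n
        (fun k => Real.cos ((m : ℝ) * k s) * Real.cos ((m : ℝ) * k s) * Real.cos ((m : ℝ) * k u)) x 0) s
        (fun u hus => hsq s u (Ne.symm hus))]
    rw [srwTwist_cos_intMul_cube_zero_eq hd s i m x]
  -- inner sums, off-diagonal pattern `s ≠ t`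
  have hoff : ∀ s t : Fin d, s ≠ t →
      ∑ u, srwTwist d n (fun k => Real.cos ((m : ℝ) * k s) * Real.cos ((m : ℝ) * k t) * Real.cos ((m : ℝ) * k u)) x 0
        = (srwI d n 0 (Pi.single i m) + srwI d n 0 (Pi.single i (2 * m) + Pi.single j m)) / 2
          + (srwI d n 0 (Pi.single i m) + srwI d n 0 (Pi.single i (2 * m) + Pi.single j m)) / 2
          + ((d : ℝ) - 2) * srwI d n 0 (Pi.single i m + Pi.single j m + Pi.single l m) := by
    intro s t hst
    rw [sum_marked₂ (fun u => srwTwist d n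
        (fun k => Real.cos ((m : ℝ) * k s) * Real.cos ((m : ℝ) * k t) * Real.cos ((m : ℝ) * k u)) x 0) hst
        (fun u hus hut => srwTwist_cos_mul_cos_mul_cos_intMul_zero_eq_ref hd hst (Ne.symm hus) (Ne.symm hut)
          hij hil hjl m x)]
    rw [hsq'' s t hst, hsq' t s (Ne.symm hst)]
  -- middle sums
  have hmid : ∀ s : Fin d,
      ∑ t, ∑ u, srwTwist d n
          (fun k => Real.cos ((m : ℝ) * k s) * Real.cos ((m : ℝ) * k t) * Real.cos ((m : ℝ) * k u)) x 0
        = ((3 * srwI d n 0 (Pi.single i m) + srwI d n 0 (Pi.single i (3 * m))) / 4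
            + ((d : ℝ) - 1) * ((srwI d n 0 (Pi.single i m) + srwI d n 0 (Pi.single i (2 * m) + Pi.single j m)) / 2))
          + ((d : ℝ) - 1) * ((srwI d n 0 (Pi.single i m) + srwI d n 0 (Pi.single i (2 * m) + Pi.single j m)) / 2
            + (srwI d n 0 (Pi.single i m) + srwI d n 0 (Pi.single i (2 * m) + Pi.single j m)) / 2
            + ((d : ℝ) - 2) * srwI d n 0 (Pi.single i m + Pi.single j m + Pi.single l m)) := by
    intro s
    rw [sum_marked₁ (fun t => ∑ u, srwTwist d n
        (fun k => Real.cos ((m : ℝ) * k s) * Real.cos ((m : ℝ) * k t) * Real.cos ((m : ℝ) * k u)) x 0) s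
        (fun t hts => hoff s t (Ne.symm hts))]
    rw [hdiag s]
  -- assemble
  rw [show (fun k => DhatSym d (Pi.single i m) k ^ 3) = fun k => ∑ s, ∑ t, ∑ u, (1 / (d : ℝ) ^ 3)
      * (Real.cos ((m : ℝ) * k s) * Real.cos ((m : ℝ) * k t) * Real.cos ((m : ℝ) * k u))
      from funext fun k => DhatSym_single_pow_three_eq_sum i m k]
  rw [srwTwist_sum₃_weight hd (1 / (d : ℝ) ^ 3)
      (fun s t u k => Real.cos ((m : ℝ) * k s) * Real.cos ((m : ℝ) * k t) * Real.cos ((m : ℝ) * k u))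
      (fun s t u => ((measurable_cos_cmul _ s).mul (measurable_cos_cmul _ t)).mul (measurable_cos_cmul _ u))
      (fun s t u k => abs_ccc_le _ _ _) x 0]
  simp only [← Finset.mul_sum]
  rw [Finset.sum_congr rfl fun s _ => hmid s, Finset.sum_const, Finset.card_univ, Fintype.card_fin,
    nsmul_eq_mul]
  field_simp
  ring

/-! ### §4  The `D^{sin}` second moment at `2e_i` -/

/-- `Sq^{w}_n(x) = Tw^{w·D̂^{(x)2}}_n(x;0)` (definitional: `cos(0·D̂^{(x)}) = 1`).
[cite: FitznerVanDerHofstad2016NoBLE, (3.34) p. 1071] -/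
theorem srwSqMom_eq_srwTwist_sq_zero (n : ℕ) (w : (Fin d → ℝ) → ℝ) (x : Fin d → ℤ) :
    srwSqMom d n w x = srwTwist d n (fun k => w k * DhatSym d x k ^ 2) x 0 := by
  simp only [srwSqMom, srwTwist, zero_mul, Real.cos_zero, mul_one]

/-- `L_n(x) = Tw^{D̂^{(x)2}}_n(x;0)`. [cite: FitznerVanDerHofstad2016NoBLE, (5.7) p. 1091] -/
theorem srwL_eq_srwTwist_sq_zero (n : ℕ) (x : Fin d → ℤ) :
    srwL d n x = srwTwist d n (fun k => DhatSym d x k ^ 2) x 0 := by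
  simp only [srwL, srwTwist, zero_mul, Real.cos_zero, mul_one]

/-- **The exact `D^{sin}` second moment at the node `2e_i`** (`d ≥ 2n+1`, `i, j, l` pairwise distinct):
`Sq^{D^{sin}}_n(2e_i) = (L_n(2e_i) − ∫ D̂^{(2e_i)3} Ĉⁿ)/(2d)` with both pieces in plain seeds —
`L_n(2e_i) = (I_{n,0}(0) + I_{n,0}(4e_i))/(2d) + ((d−1)/d) I_{n,0}(2e_i + 2e_j)` and the cube by
`srwTwist_DhatSym_single_pow_three_zero_eq` at `m = 2` (classes `[2,2,2]`, `[2]`, `[4,2]`, `[6]`).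
[cite: FitznerVanDerHofstad2016NoBLE, (3.34)–(3.38) p. 1071; (5.7), (5.9) pp. 1091–1092] -/
theorem srwSqMom_abs_Dhat_pow_zero_mul_Dsin_single_two_eq {n : ℕ} (hd : 2 * n + 1 ≤ d) {i j l : Fin d}
    (hij : i ≠ j) (hil : i ≠ l) (hjl : j ≠ l) :
    srwSqMom d n (fun k => |Dhat d k| ^ 0 * Dsin d k) (Pi.single i 2)
      = ((srwI d n 0 0 + srwI d n 0 (Pi.single i 4)) / (2 * d)
          + ((d : ℝ) - 1) / d * srwI d n 0 (Pi.single i 2 + Pi.single j 2)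
          - (((d : ℝ) - 1) * ((d : ℝ) - 2) / (d : ℝ) ^ 2
                * srwI d n 0 (Pi.single i 2 + Pi.single j 2 + Pi.single l 2)
              + 3 * ((d : ℝ) - 1) / (2 * (d : ℝ) ^ 2)
                * (srwI d n 0 (Pi.single i 2) + srwI d n 0 (Pi.single i 4 + Pi.single j 2))
              + 1 / (4 * (d : ℝ) ^ 2) * (3 * srwI d n 0 (Pi.single i 2) + srwI d n 0 (Pi.single i 6))))
        / (2 * d) := by
  have hd1 : 1 ≤ d := by omega
  have hD2m : Measurable fun k : Fin d → ℝ => DhatSym d (Pi.single i 2) k ^ 2 :=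
    (measurable_DhatSym d _).pow_const 2
  have hD3m : Measurable fun k : Fin d → ℝ => DhatSym d (Pi.single i 2) k ^ 3 :=
    (measurable_DhatSym d _).pow_const 3
  have hD2b : ∀ k : Fin d → ℝ, |DhatSym d (Pi.single i 2) k ^ 2| ≤ 1 := fun k => by
    rw [abs_pow]; exact pow_le_one₀ (abs_nonneg _) (abs_DhatSym_le_one _ _)
  have hD3b : ∀ k : Fin d → ℝ, |DhatSym d (Pi.single i 2) k ^ 3| ≤ 1 := fun k => by
    rw [abs_pow]; exact pow_le_one₀ (abs_nonneg _) (abs_DhatSym_le_one _ _)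
  have hw : (fun k : Fin d → ℝ => (|Dhat d k| ^ 0 * Dsin d k) * DhatSym d (Pi.single i 2) k ^ 2)
      = fun k => (1 / (2 * (d : ℝ))) * DhatSym d (Pi.single i 2) k ^ 2
          + (-(1 / (2 * (d : ℝ)))) * DhatSym d (Pi.single i 2) k ^ 3 := by
    funext k
    rw [pow_zero, one_mul, Dsin_eq_half_angle hd1 k, ← DhatSym_single_two i k]
    ring
  have hL := srwL_single_eq_classes hd hij (2 : ℤ)
  rw [show (2 : ℤ) * 2 = 4 by norm_num] at hL
  have hC := srwTwist_DhatSym_single_pow_three_zero_eq hd hij hil hjl 2 (Pi.single i 2)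
  rw [show (2 : ℤ) * 2 = 4 by norm_num, show (3 : ℤ) * 2 = 6 by norm_num] at hC
  rw [srwSqMom_eq_srwTwist_sq_zero, hw, lin₂ hd _ _ _ _ hD2m hD3m hD2b hD3b _ 0, ← srwL_eq_srwTwist_sq_zero,
    hL, hC]
  ring

/-! ### §5  The `ℚ`-literal enclosure consumed by the `U_{n,0}(2e_i)` cells -/

/-- **`S` input of the KU-SEP `U_{n,0}` row at `2e_i`, exact-in-classes form.** Upper seed bounds `B₀, B₄, B₂₂`
for `I_{n,0}` at `0`, `4e_i`, `2e_i+2e_j` and LOWER seed bounds `z₂, z₂₂₂, z₄₂, z₆` for `I_{n,0}` at `2e_i`,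
`2e_i+2e_j+2e_l`, `4e_i+2e_j`, `6e_i` (the cube enters with a minus sign) give
`Sq^{D^{sin}}_n(2e_i) ≤ ((B₀+B₄)/(2d) + ((d−1)/d) B₂₂ − [((d−1)(d−2)/d²) z₂₂₂ + (3(d−1)/(2d²))(z₂+z₄₂)
  + (1/(4d²))(3z₂+z₆)])/(2d)` (`d ≥ 2n+1`, three distinct indices, so `d ≥ 3`).
[cite: FitznerVanDerHofstad2016NoBLE, (3.34)–(3.38) p. 1071; (5.9) p. 1092] -/
theorem srwSqMom_abs_Dhat_pow_zero_mul_Dsin_single_two_le_cube_cast {n : ℕ} (hd : 2 * n + 1 ≤ d)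
    {i j l : Fin d} (hij : i ≠ j) (hil : i ≠ l) (hjl : j ≠ l) {B₀ B₄ B₂₂ z₂ z₂₂₂ z₄₂ z₆ : ℚ}
    (h0 : srwI d n 0 0 ≤ (B₀ : ℝ)) (h4 : srwI d n 0 (Pi.single i 4) ≤ (B₄ : ℝ))
    (h22 : srwI d n 0 (Pi.single i 2 + Pi.single j 2) ≤ (B₂₂ : ℝ))
    (g2 : (z₂ : ℝ) ≤ srwI d n 0 (Pi.single i 2))
    (g222 : (z₂₂₂ : ℝ) ≤ srwI d n 0 (Pi.single i 2 + Pi.single j 2 + Pi.single l 2))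
    (g42 : (z₄₂ : ℝ) ≤ srwI d n 0 (Pi.single i 4 + Pi.single j 2))
    (g6 : (z₆ : ℝ) ≤ srwI d n 0 (Pi.single i 6)) :
    srwSqMom d n (fun k => |Dhat d k| ^ 0 * Dsin d k) (Pi.single i 2)
      ≤ ((((B₀ + B₄) / (2 * d) + ((d : ℚ) - 1) / d * B₂₂
            - (((d : ℚ) - 1) * ((d : ℚ) - 2) / (d : ℚ) ^ 2 * z₂₂₂
                + 3 * ((d : ℚ) - 1) / (2 * (d : ℚ) ^ 2) * (z₂ + z₄₂)
                + 1 / (4 * (d : ℚ) ^ 2) * (3 * z₂ + z₆))) / (2 * d) : ℚ) : ℝ) := by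
  have hd3 : 3 ≤ d := by
    have h := Fintype.two_lt_card_iff.mpr ⟨i, j, l, hij, hil, hjl⟩
    simp only [Fintype.card_fin] at h
    omega
  have hdR : (3 : ℝ) ≤ d := by exact_mod_cast hd3
  have hc1 : 0 ≤ ((d : ℝ) - 1) * ((d : ℝ) - 2) / (d : ℝ) ^ 2 :=
    div_nonneg (mul_nonneg (by linarith) (by linarith)) (by positivity)
  have hc2 : 0 ≤ 3 * ((d : ℝ) - 1) / (2 * (d : ℝ) ^ 2) :=
    div_nonneg (by linarith) (by positivity)
  have hc3 : (0 : ℝ) ≤ 1 / (4 * (d : ℝ) ^ 2) := by positivity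
  have hc4 : 0 ≤ ((d : ℝ) - 1) / d := div_nonneg (by linarith) (by positivity)
  have hc5 : (0 : ℝ) ≤ 2 * d := by positivity
  rw [srwSqMom_abs_Dhat_pow_zero_mul_Dsin_single_two_eq hd hij hil hjl]
  have key : ((srwI d n 0 0 + srwI d n 0 (Pi.single i 4)) / (2 * d)
          + ((d : ℝ) - 1) / d * srwI d n 0 (Pi.single i 2 + Pi.single j 2)
          - (((d : ℝ) - 1) * ((d : ℝ) - 2) / (d : ℝ) ^ 2
                * srwI d n 0 (Pi.single i 2 + Pi.single j 2 + Pi.single l 2)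
              + 3 * ((d : ℝ) - 1) / (2 * (d : ℝ) ^ 2)
                * (srwI d n 0 (Pi.single i 2) + srwI d n 0 (Pi.single i 4 + Pi.single j 2))
              + 1 / (4 * (d : ℝ) ^ 2) * (3 * srwI d n 0 (Pi.single i 2) + srwI d n 0 (Pi.single i 6))))
        / (2 * d)
      ≤ (((B₀ : ℝ) + B₄) / (2 * d) + ((d : ℝ) - 1) / d * B₂₂
          - (((d : ℝ) - 1) * ((d : ℝ) - 2) / (d : ℝ) ^ 2 * z₂₂₂
              + 3 * ((d : ℝ) - 1) / (2 * (d : ℝ) ^ 2) * (z₂ + z₄₂)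
              + 1 / (4 * (d : ℝ) ^ 2) * (3 * z₂ + z₆))) / (2 * d) := by
    refine div_le_div_of_nonneg_right (sub_le_sub (add_le_add ?_ ?_) (add_le_add (add_le_add ?_ ?_) ?_)) hc5
    · exact div_le_div_of_nonneg_right (add_le_add h0 h4) hc5
    · exact mul_le_mul_of_nonneg_left h22 hc4
    · exact mul_le_mul_of_nonneg_left g222 hc1
    · exact mul_le_mul_of_nonneg_left (add_le_add g2 g42) hc2
    · exact mul_le_mul_of_nonneg_left (by linarith) hc3
  refine key.trans (le_of_eq ?_)
  push_cast
  ring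

end DsinCube

end Literature.Probability.FitznerVanDerHofstad2017
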